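import Literature.Probability.FitznerVanDerHofstad2017.NobleBoundingEventsIota
import Literature.Probability.FitznerVanDerHofstad2017.NobleBoundingEventsProductN
import HarnessLib

/-!
# [FvdH17] §4.4, the product bound (4.70) on `Ξ^{(N),ι}` for every `N ≥ 1`, PROVED in the single-level reading

Source: R. Fitzner, R. van der Hofstad, *Mean-field behavior for nearest-neighbor percolation in `d > 10`*,
Electron. J. Probab. **22** (2017) no. 43 [FvdH17], §4.4, "Bound in terms of simpler diagrams", second part
(arXiv:1506.07977v2 pp. 44–45 = EJP pp. 40–42).  PRINTED TEXT (4.70) (v2 p. 45 = EJP p. 41):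
`Ξ^{(N),ι}_p(x) ≤ Σ_{t⃗,w⃗,z⃗,b⃗} p^N P_p(F^ι_0(b₀,w₀,z₁) ∩ {b̄₀ ∉ C̃₀}) Π_{i=1}^{N-1} P_p^{b̲_{i-1}}(F_i(b_{i-1},t_i,z_i,b_i,
w_i,z_{i+1}) ∩ {b̄_i ∉ C̃_i}) P_p^{b̲_{N-1}}(F_N(b_{N-1},t_N,z_N,x))` with `F^ι_0 = F^{ι,I}_0 ∪ F^{ι,II}_0 ∪ F^{ι,III}_0`
((4.66)–(4.68)); the text derives it from (4.69) for the first part `Ξ^{b_ι,(N)}(0,x;{e_ι})` of `Ξ^{(N),ι}` ((3.55)) and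
from (4.71)–(4.72) for the second part `p 𝔼^{b_ι}_0[𝟙{e_ι ∉ C̃^{b_ι}(0)} Ξ^{B(0),(N-1)}(e_ι,x; C̃^{b_ι}(0))]`.

This module PROVES, for the tree's `nobleXiIotaT d p e (N+1) x` (= (3.55) with outer data `({b_ι},∅)`, resp.
`(B(0),{0})`), the bound

  `nobleXiIotaT_succ_le :  Ξ^{(N+1),ι}(x) ≤ Σ_{b₀} Σ_{z₁} J(b₀) · (Σ_{w₀} P^{b_ι}(F^{ι,I}_0 ∪ F^{ι,II}_0)(b₀,w₀,z₁)) · K_N(b₀,z₁)`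
  `                                      + Σ_{z₁} P_p(F^{ι,III}_0((0,e_ι),0,z₁)) · K_N((0,e_ι),z₁)`,

`K_N = nobleLevelK d p x N` the iterated level factor of `NobleBoundingEventsProductN` (levels `1, …, N`; its
relation to the printed product, including the extra `z_{i+1} = b̲_{i-1}` terms, is recorded there and in DIVERGENCE
D59 (b)).  Level `0` of the first part is `measure_nobleCell_iota_inter_le_tsum` ((4.69), module
`NobleBoundingEventsIota`); level `1` of the second part is `nobleIter_nobleKerXi_le` at the bond `(0,e_ι)` — whose
one-level factor is exactly the instance `(u,v) = (0,e_ι)` of (4.64), i.e. (4.71) — and its level `0` is (4.72)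
(`ofReal_mul_measure_le_eventFiotaIII`).  READINGS (neutral, as in the sibling modules): the indicator `{b̄₀ ∉ C̃₀}`
of (4.70) is dropped (an upper bound); `P^{b_ι}` (off `b_ι`, as the events (4.66)–(4.67) require `{b_ι vacant}`) is
kept on the first part; in the `F^{ι,III}` part the printed sum over `(b₀,w₀)` collapses to `b₀ = (0,e_ι)`, `w₀ = 0` by
the constraints of (4.68).

Nothing in this module is a cited hypothesis.
-/

noncomputable section

namespace Literature.Probability.FitznerVanDerHofstad2017

open _root_.MeasureTheory Literature.Barriers.CriticalPhenomena Literature.Probability.Percolation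
open Literature.Probability.LatticeModels _root_.SimpleGraph
open scoped ENNReal

variable {d : ℕ}

/-- `Ξ^{B(w),{w},(N)}(A,v,x) = (𝒩ᴺ nobleKerXi)(w)(A,v,x)`: with outer data `(B(w),{w})` the `N`-fold coefficient is the
`N`-th iterate of the one-level operator applied to the innermost kernel ((3.44)/(3.47) read from the inside).
[cite: FitznerVanDerHofstad2017, (3.44)–(3.47) (arXiv:1506.07977v2 pp. 28–29)] -/
theorem nobleXiBT_bondsAt_eq_nobleIter (p : unitInterval) (N : ℕ) (w : Site d) (A : Set (Site d)) (v x : Site d) :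
    nobleXiBT d p (bondsAt {w}) {w} N A v x = nobleIter d p (nobleKerXi d p) N w A v x := by
  cases N with
  | zero => rw [nobleXiBT_zero, nobleIter_zero, nobleKerXi_apply]
  | succ n => rw [nobleXiBT_succ, nobleIter_succ, nobleOpW_apply]

/-- **First part of (4.70)**: `Ξ^{b_ι,(N+1)}(0,x;{e_ι}) ≤ Σ_{b₀} Σ_{z₁} J(b₀) · (Σ_{w₀} P^{b_ι}(F^{ι,I}_0 ∪ F^{ι,II}_0)
(b₀,w₀,z₁)) · K_N(b₀,z₁)` — the one-level engine with level `0` bounded by (4.69).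
[cite: FitznerVanDerHofstad2017, (4.69)–(4.70) (arXiv:1506.07977v2 p. 45; EJP 22 (2017) no. 43 p. 41)] -/
theorem nobleXiBT_iota_succ_le (p : unitInterval) (e : Site d) (N : ℕ) (x : Site d) :
    nobleXiBT d p {s(0, e)} ∅ (N + 1) {e} 0 x ≤ ∑' b : Site d × Site d, ∑' z : Site d,
      ENNReal.ofReal (bondJ d p (b.2 - b.1)) *
        ((∑' w : Site d, probOff d p {s(0, e)} (eventFiotaI e b.1 b.2 w z ∪ eventFiotaII e b.1 b.2 w z)) *
          nobleLevelK d p x N b z) := by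
  classical
  rw [nobleXiBT_succ]
  refine (nobleOp_le_tsum_of_kernel_le p {s(0, e)} ∅ (nobleIter d p (nobleKerXi d p) N) {e} 0 x
    (nobleLevelK d p x N) (nobleIter_nobleKerXi_le p x N)).trans ?_
  refine ENNReal.tsum_le_tsum fun b => ENNReal.tsum_le_tsum fun z => mul_le_mul' le_rfl ?_
  by_cases hz : z = b.1
  · rw [hz, nobleLevelK_self_eq_zero, mul_zero, mul_zero]
  · refine mul_le_mul' ?_ le_rfl
    simp only [Set.union_empty]
    exact measure_nobleCell_iota_inter_le_tsum p hz

/-- **Second part of (4.70)**: `p 𝔼^{b_ι}_0[𝟙{e_ι ∉ C̃^{b_ι}(0)} Ξ^{B(0),(N)}(e_ι,x; C̃^{b_ι}(0))] ≤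
Σ_{z₁} P_p(F^{ι,III}_0((0,e_ι),0,z₁)) · K_N((0,e_ι),z₁)` — levels `1,…,N` by `nobleIter_nobleKerXi_le` at the bond
`(0,e_ι)` ((4.71) is its first level), Tonelli over `z₁ ∈ C̃^{b_ι}(0)`, and (4.72) for the factor `p`.
[cite: FitznerVanDerHofstad2017, (4.70)–(4.72) (arXiv:1506.07977v2 p. 45; EJP 22 (2017) no. 43 pp. 41–42)] -/
theorem ofReal_mul_nobleIotaCorr_le (p : unitInterval) {e : Site d} (he : (zdGraph d).Adj 0 e) (N : ℕ)
    (x : Site d) :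
    ENNReal.ofReal p * nobleIotaCorr d p e (fun C => nobleXiBT d p (bondsAt {0}) {0} N C e x) ≤
      ∑' z : Site d, bondPercolation (zdGraph d) p (eventFiotaIII e 0 e 0 z) * nobleLevelK d p x N (0, e) z := by
  classical
  have he0 : (0 : Site d) ≠ e := he.ne
  have hG : ∀ C : Set (Site d), nobleXiBT d p (bondsAt {0}) {0} N C e x ≤
      ∑' z : Site d, C.indicator (nobleLevelK d p x N (0, e)) z := by
    intro C
    rw [nobleXiBT_bondsAt_eq_nobleIter]
    exact nobleIter_nobleKerXi_le p x N (0, e) he0 C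
  set S : Site d → Set (BondConfig (Site d)) := fun z =>
    {ω | z ∈ restrCluster 0 e 0 (offBonds {s(0, e)} ω) ∧ e ∉ restrCluster 0 e 0 (offBonds {s(0, e)} ω)}
    with hS
  have hm : Measurable fun ω : BondConfig (Site d) => restrCluster 0 e 0 (offBonds {s(0, e)} ω) :=
    (measurable_restrCluster 0 e 0).comp (measurable_offBonds _)
  have hSm : ∀ z : Site d, MeasurableSet (S z) := fun z =>
    measurableSet_setOf.2 ((measurable_set_iff.1 hm z).and (measurable_set_iff.1 hm e).not)
  have hcorr : nobleIotaCorr d p e (fun C => nobleXiBT d p (bondsAt {0}) {0} N C e x) ≤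
      ∑' z : Site d, bondPercolation (zdGraph d) p (S z) * nobleLevelK d p x N (0, e) z := by
    unfold nobleIotaCorr
    calc ∫⁻ ω, {ω | e ∉ restrCluster 0 e 0 (offBonds {s(0, e)} ω)}.indicator
            (fun ω => nobleXiBT d p (bondsAt {0}) {0} N (restrCluster 0 e 0 (offBonds {s(0, e)} ω)) e x) ω
            ∂(bondPercolation (zdGraph d) p)
        ≤ ∫⁻ ω, ∑' z : Site d, (S z).indicator (fun _ => nobleLevelK d p x N (0, e) z) ω
            ∂(bondPercolation (zdGraph d) p) := by
          refine lintegral_mono fun ω => ?_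
          by_cases hω : e ∉ restrCluster 0 e 0 (offBonds {s(0, e)} ω)
          · rw [Set.indicator_of_mem (show ω ∈ {ω | e ∉ restrCluster 0 e 0 (offBonds {s(0, e)} ω)} from hω)]
            refine (hG _).trans (le_of_eq (tsum_congr fun z => ?_))
            by_cases hz : z ∈ restrCluster 0 e 0 (offBonds {s(0, e)} ω)
            · rw [Set.indicator_of_mem hz, Set.indicator_of_mem (show ω ∈ S z from ⟨hz, hω⟩)]
            · rw [Set.indicator_of_notMem hz, Set.indicator_of_notMem (show ω ∉ S z from fun h => hz h.1)]
          · rw [Set.indicator_of_notMem (show ω ∉ {ω | e ∉ restrCluster 0 e 0 (offBonds {s(0, e)} ω)} from hω)]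
            exact zero_le
      _ = ∑' z : Site d, bondPercolation (zdGraph d) p (S z) * nobleLevelK d p x N (0, e) z := by
          rw [lintegral_tsum fun z => (measurable_const.indicator (hSm z)).aemeasurable]
          exact tsum_congr fun z => by rw [lintegral_indicator_const (hSm z), mul_comm]
  calc ENNReal.ofReal p * nobleIotaCorr d p e (fun C => nobleXiBT d p (bondsAt {0}) {0} N C e x)
      ≤ ENNReal.ofReal p * ∑' z : Site d, bondPercolation (zdGraph d) p (S z) * nobleLevelK d p x N (0, e) z :=
        mul_le_mul' le_rfl hcorr
    _ = ∑' z : Site d, ENNReal.ofReal p * bondPercolation (zdGraph d) p (S z) * nobleLevelK d p x N (0, e) z := by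
        rw [← ENNReal.tsum_mul_left]
        exact tsum_congr fun z => (mul_assoc _ _ _).symm
    _ ≤ ∑' z : Site d, bondPercolation (zdGraph d) p (eventFiotaIII e 0 e 0 z) * nobleLevelK d p x N (0, e) z := by
        refine ENNReal.tsum_le_tsum fun z => ?_
        by_cases hz : z = 0
        · rw [hz, show nobleLevelK d p x N (0, e) 0 = 0 from nobleLevelK_self_eq_zero p x N (0, e), mul_zero,
            mul_zero]
        · exact mul_le_mul' (ofReal_mul_measure_le_eventFiotaIII p he hz) le_rfl

/-- **(4.70), all `N ≥ 1`, single-level reading** (`e = e_ι` a neighbour of `0`):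
`Ξ^{(N+1),ι}(x) ≤ Σ_{b₀} Σ_{z₁} J(b₀) · (Σ_{w₀} P^{b_ι}(F^{ι,I}_0 ∪ F^{ι,II}_0)(b₀,w₀,z₁)) · K_N(b₀,z₁)
+ Σ_{z₁} P_p(F^{ι,III}_0((0,e_ι),0,z₁)) · K_N((0,e_ι),z₁)` (module docstring for the readings).
[cite: FitznerVanDerHofstad2017, (4.70) (arXiv:1506.07977v2 p. 45; EJP 22 (2017) no. 43 p. 41)] -/
theorem nobleXiIotaT_succ_le (p : unitInterval) {e : Site d} (he : (zdGraph d).Adj 0 e) (N : ℕ) (x : Site d) :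
    nobleXiIotaT d p e (N + 1) x ≤
      (∑' b : Site d × Site d, ∑' z : Site d, ENNReal.ofReal (bondJ d p (b.2 - b.1)) *
        ((∑' w : Site d, probOff d p {s(0, e)} (eventFiotaI e b.1 b.2 w z ∪ eventFiotaII e b.1 b.2 w z)) *
          nobleLevelK d p x N b z)) +
      ∑' z : Site d, bondPercolation (zdGraph d) p (eventFiotaIII e 0 e 0 z) * nobleLevelK d p x N (0, e) z := by
  have h : nobleXiIotaT d p e (N + 1) x = nobleXiBT d p {s(0, e)} ∅ (N + 1) {e} 0 x +
      ENNReal.ofReal p * nobleIotaCorr d p e (fun C => nobleXiBT d p (bondsAt {0}) {0} N C e x) := rfl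
  rw [h]
  exact add_le_add (nobleXiBT_iota_succ_le p e N x) (ofReal_mul_nobleIotaCorr_le p he N x)

end Literature.Probability.FitznerVanDerHofstad2017
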